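import Summits.Ventures.Crystal3D.Theorems.StickyWulffConstantTextureBuildLabelledCells
import Summits.Ventures.Crystal3D.Theorems.StickyWulffConstantPolycrystalWulffBoundMinkowskiSignedRefinement
import HarnessLib

/-!
# TB-D assembly, part 15: LABELLED CELLS FROM AN ARRANGEMENT — the signed refinement of the P-lane, repackaged
# (lane T, crux `TextureLiminfV5`, stmt-Ventures-23912; blueprint HOME/wulff-p2/g20/TB-D-2-g20.md §1 (1b))

HONEST FRAMING. Venture `Summits/Ventures/Crystal3D` (cell `crystal3d-full`), route `route-Ventures-StickyWulffConstant`, helper `--supports` the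
law-v5 crux `TextureLiminfV5` (stmt-Ventures-23912).  One DEFINITION by choice + its specification (census-free, standard axioms): the P-lane's
`exists_signed_refinement` (…MinkowskiSignedRefinement, stmt-Ventures-19482 machinery) delivered in the vocabulary of …TextureBuildLabelledCells /
…TextureBuildCellFlip (`signedH`, `polytope`), so that the mesh-specific file '…TextureBuildCells' only has to supply the plane set `𝓗`, the bounded family
`𝒢` and the labelling rule.  F-C1 not moved.

* `refineCells 𝓗 h1 𝒢 h𝒢 hb n lab₀ : LabelledCells` — the cells of the arrangement of `𝓗` that lie in `⋃_{G ∈ 𝒢} polytope G` (nonempty, bounded, pairwise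
  distinct positive parts), labelled by `lab₀` applied to the positive part;
* specification: `refineCells_𝓗`, `refineCells_lab`, `refineCells_good` (each cell's positive part contains some `G ∈ 𝒢`, i.e. the cell lies in `polytope G`),
  `refineCells_dichotomy` (for every `G ⊆ 𝓗`: inside `polytope G` or disjoint from it), `refineCells_complete` (every nonempty good sign vector is a cell),
  `refineCells_ae_cover` (the cells exhaust `⋃ polytope G` a.e.), `refineCells_subset` (and lie inside it).
The instance-level mismatch between the generic arrangement files (`if p ∈ T` under classical decidability of a general `E`) and `E3` is bridged pointwise
through the two instance-free membership characterisations (`mem_arrCell_iff` there, `mem_polytope_signedH_iff` here).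
-/

noncomputable section

namespace Summit.Ventures.Crystal3D.Cruxes.TextureLiminf.TexShadow

open Summit.Ventures.Crystal3D Summit.Ventures.Crystal3D.Theorems MeasureTheory Set
open scoped InnerProductSpace

section Refine

/-- The signed refinement, with the cells rewritten as `polytope (signedH 𝓗 (T j))`. -/
theorem exists_refinement_signedH (𝓗 : Finset (E3 × ℝ)) (h1 : ∀ p ∈ 𝓗, ‖p.1‖ = 1) (𝒢 : Finset (Finset (E3 × ℝ))) (h𝒢 : ∀ G ∈ 𝒢, G ⊆ 𝓗)
    (hb : ∀ G ∈ 𝒢, Bornology.IsBounded (polytope G)) :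
    ∃ (k : ℕ) (T : Fin k → Finset (E3 × ℝ)), (∀ j, T j ⊆ 𝓗) ∧ Function.Injective T ∧
      (∀ j, (polytope (signedH 𝓗 (T j))).Nonempty) ∧ (∀ j, Bornology.IsBounded (polytope (signedH 𝓗 (T j)))) ∧
      (∀ j, ∃ G ∈ 𝒢, G ⊆ T j) ∧
      (∀ j, ∀ G : Finset (E3 × ℝ), G ⊆ 𝓗 → polytope (signedH 𝓗 (T j)) ⊆ polytope G ∨ Disjoint (polytope (signedH 𝓗 (T j))) (polytope G)) ∧
      (∀ T' : Finset (E3 × ℝ), T' ⊆ 𝓗 → (∃ G ∈ 𝒢, G ⊆ T') → (polytope (signedH 𝓗 T')).Nonempty → ∃ j, T j = T') ∧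
      (∀ j, polytope (signedH 𝓗 (T j)) ⊆ ⋃ G ∈ 𝒢, polytope G) ∧
      ((⋃ G ∈ 𝒢, polytope G) =ᵐ[volume] ⋃ j, polytope (signedH 𝓗 (T j))) := by
  obtain ⟨k, T, ν, c1, c2, c3, c4, -, c6, -, c8, -, -, -, -, c13, c14, c15⟩ := exists_signed_refinement 𝓗 h1 𝒢 h𝒢 hb
  -- pointwise bridge between the two spellings of a cell
  have to' : ∀ (T' : Finset (E3 × ℝ)) x, x ∈ polytope (signedH 𝓗 T') → x ∈ _ := fun T' x hx =>
    (mem_arrCell_iff 𝓗 T' x).2 ((mem_polytope_signedH_iff 𝓗 T' x).1 hx)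
  have fro : ∀ (T' : Finset (E3 × ℝ)) x, x ∈ _ → x ∈ polytope (signedH 𝓗 T') := fun T' x hx =>
    (mem_polytope_signedH_iff 𝓗 T' x).2 ((mem_arrCell_iff 𝓗 T' x).1 hx)
  have key : ∀ T' : Finset (E3 × ℝ), polytope (signedH 𝓗 T') = _ := fun T' => Set.ext fun x => ⟨to' T' x, fro T' x⟩
  refine ⟨k, T, c1, fun j j' h => by_contra fun hne => c2 j j' hne h, fun j => ?_, fun j => ?_, c4, fun j G hG => ?_, fun T' hT' hG hne => ?_,
    fun j => ?_, ?_⟩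
  · rw [key]; exact c6 j
  · rw [key]; exact c8 j
  · rw [key]; exact c15 j G hG
  · exact c3 T' hT' hG (by rw [← key]; exact hne)
  · rw [key]; exact c13 j
  · rw [Set.iUnion_congr fun j => key (T j)]; exact c14

/-- **LABELLED CELLS FROM AN ARRANGEMENT**: the good cells of `𝓗` inside `⋃ 𝒢`, labelled by `lab₀` on their positive parts. -/
def refineCells (𝓗 : Finset (E3 × ℝ)) (h1 : ∀ p ∈ 𝓗, ‖p.1‖ = 1) (𝒢 : Finset (Finset (E3 × ℝ))) (h𝒢 : ∀ G ∈ 𝒢, G ⊆ 𝓗)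
    (hb : ∀ G ∈ 𝒢, Bornology.IsBounded (polytope G)) (n : ℕ) (lab₀ : Finset (E3 × ℝ) → Option (Fin n)) : LabelledCells :=
  { 𝓗 := 𝓗
    h1 := h1
    k := Classical.choose (exists_refinement_signedH 𝓗 h1 𝒢 h𝒢 hb)
    T := Classical.choose (Classical.choose_spec (exists_refinement_signedH 𝓗 h1 𝒢 h𝒢 hb))
    hT := (Classical.choose_spec (Classical.choose_spec (exists_refinement_signedH 𝓗 h1 𝒢 h𝒢 hb))).1
    hne := (Classical.choose_spec (Classical.choose_spec (exists_refinement_signedH 𝓗 h1 𝒢 h𝒢 hb))).2.2.1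
    hbd := (Classical.choose_spec (Classical.choose_spec (exists_refinement_signedH 𝓗 h1 𝒢 h𝒢 hb))).2.2.2.1
    hinj := (Classical.choose_spec (Classical.choose_spec (exists_refinement_signedH 𝓗 h1 𝒢 h𝒢 hb))).2.1
    n := n
    lab := fun j => lab₀ (Classical.choose (Classical.choose_spec (exists_refinement_signedH 𝓗 h1 𝒢 h𝒢 hb)) j) }

/-- The arrangement is `𝓗`. -/
theorem refineCells_𝓗 (𝓗 : Finset (E3 × ℝ)) (h1 : ∀ p ∈ 𝓗, ‖p.1‖ = 1) (𝒢 : Finset (Finset (E3 × ℝ))) (h𝒢 : ∀ G ∈ 𝒢, G ⊆ 𝓗)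
    (hb : ∀ G ∈ 𝒢, Bornology.IsBounded (polytope G)) (n : ℕ) (lab₀ : Finset (E3 × ℝ) → Option (Fin n)) : (refineCells 𝓗 h1 𝒢 h𝒢 hb n lab₀).𝓗 = 𝓗 := rfl

/-- The number of classes is `n`. -/
theorem refineCells_n (𝓗 : Finset (E3 × ℝ)) (h1 : ∀ p ∈ 𝓗, ‖p.1‖ = 1) (𝒢 : Finset (Finset (E3 × ℝ))) (h𝒢 : ∀ G ∈ 𝒢, G ⊆ 𝓗)
    (hb : ∀ G ∈ 𝒢, Bornology.IsBounded (polytope G)) (n : ℕ) (lab₀ : Finset (E3 × ℝ) → Option (Fin n)) : (refineCells 𝓗 h1 𝒢 h𝒢 hb n lab₀).n = n := rfl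

/-- The label is `lab₀` of the positive part. -/
theorem refineCells_lab (𝓗 : Finset (E3 × ℝ)) (h1 : ∀ p ∈ 𝓗, ‖p.1‖ = 1) (𝒢 : Finset (Finset (E3 × ℝ))) (h𝒢 : ∀ G ∈ 𝒢, G ⊆ 𝓗)
    (hb : ∀ G ∈ 𝒢, Bornology.IsBounded (polytope G)) (n : ℕ) (lab₀ : Finset (E3 × ℝ) → Option (Fin n)) (j : Fin (refineCells 𝓗 h1 𝒢 h𝒢 hb n lab₀).k) :
    (refineCells 𝓗 h1 𝒢 h𝒢 hb n lab₀).lab j = lab₀ ((refineCells 𝓗 h1 𝒢 h𝒢 hb n lab₀).T j) := rfl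

/-- Every cell's positive part contains some `G ∈ 𝒢` (the cell lies in `polytope G`). -/
theorem refineCells_good (𝓗 : Finset (E3 × ℝ)) (h1 : ∀ p ∈ 𝓗, ‖p.1‖ = 1) (𝒢 : Finset (Finset (E3 × ℝ))) (h𝒢 : ∀ G ∈ 𝒢, G ⊆ 𝓗)
    (hb : ∀ G ∈ 𝒢, Bornology.IsBounded (polytope G)) (n : ℕ) (lab₀ : Finset (E3 × ℝ) → Option (Fin n)) (j : Fin (refineCells 𝓗 h1 𝒢 h𝒢 hb n lab₀).k) : ∃ G ∈ 𝒢, G ⊆ (refineCells 𝓗 h1 𝒢 h𝒢 hb n lab₀).T j :=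
  (Classical.choose_spec (Classical.choose_spec (exists_refinement_signedH 𝓗 h1 𝒢 h𝒢 hb))).2.2.2.2.1 j

/-- **Dichotomy**: a cell lies inside, or is disjoint from, every polytope cut out by constraints from `𝓗`. -/
theorem refineCells_dichotomy (𝓗 : Finset (E3 × ℝ)) (h1 : ∀ p ∈ 𝓗, ‖p.1‖ = 1) (𝒢 : Finset (Finset (E3 × ℝ))) (h𝒢 : ∀ G ∈ 𝒢, G ⊆ 𝓗)
    (hb : ∀ G ∈ 𝒢, Bornology.IsBounded (polytope G)) (n : ℕ) (lab₀ : Finset (E3 × ℝ) → Option (Fin n)) (j : Fin (refineCells 𝓗 h1 𝒢 h𝒢 hb n lab₀).k) (G : Finset (E3 × ℝ)) (hG : G ⊆ 𝓗) :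
    (refineCells 𝓗 h1 𝒢 h𝒢 hb n lab₀).cell j ⊆ polytope G ∨ Disjoint ((refineCells 𝓗 h1 𝒢 h𝒢 hb n lab₀).cell j) (polytope G) :=
  (Classical.choose_spec (Classical.choose_spec (exists_refinement_signedH 𝓗 h1 𝒢 h𝒢 hb))).2.2.2.2.2.1 j G hG

/-- **Completeness**: every nonempty good sign vector is a cell. -/
theorem refineCells_complete (𝓗 : Finset (E3 × ℝ)) (h1 : ∀ p ∈ 𝓗, ‖p.1‖ = 1) (𝒢 : Finset (Finset (E3 × ℝ))) (h𝒢 : ∀ G ∈ 𝒢, G ⊆ 𝓗)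
    (hb : ∀ G ∈ 𝒢, Bornology.IsBounded (polytope G)) (n : ℕ) (lab₀ : Finset (E3 × ℝ) → Option (Fin n)) (T' : Finset (E3 × ℝ)) (hT' : T' ⊆ 𝓗) (hG : ∃ G ∈ 𝒢, G ⊆ T') (hne : (polytope (signedH 𝓗 T')).Nonempty) :
    ∃ j, (refineCells 𝓗 h1 𝒢 h𝒢 hb n lab₀).T j = T' :=
  (Classical.choose_spec (Classical.choose_spec (exists_refinement_signedH 𝓗 h1 𝒢 h𝒢 hb))).2.2.2.2.2.2.1 T' hT' hG hne

/-- Cells lie inside `⋃ polytope G`. -/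
theorem refineCells_subset (𝓗 : Finset (E3 × ℝ)) (h1 : ∀ p ∈ 𝓗, ‖p.1‖ = 1) (𝒢 : Finset (Finset (E3 × ℝ))) (h𝒢 : ∀ G ∈ 𝒢, G ⊆ 𝓗)
    (hb : ∀ G ∈ 𝒢, Bornology.IsBounded (polytope G)) (n : ℕ) (lab₀ : Finset (E3 × ℝ) → Option (Fin n)) (j : Fin (refineCells 𝓗 h1 𝒢 h𝒢 hb n lab₀).k) :
    (refineCells 𝓗 h1 𝒢 h𝒢 hb n lab₀).cell j ⊆ ⋃ G ∈ 𝒢, polytope G :=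
  (Classical.choose_spec (Classical.choose_spec (exists_refinement_signedH 𝓗 h1 𝒢 h𝒢 hb))).2.2.2.2.2.2.2.1 j

/-- **A.e. cover**: the cells exhaust `⋃ polytope G` up to a null set. -/
theorem refineCells_ae_cover (𝓗 : Finset (E3 × ℝ)) (h1 : ∀ p ∈ 𝓗, ‖p.1‖ = 1) (𝒢 : Finset (Finset (E3 × ℝ))) (h𝒢 : ∀ G ∈ 𝒢, G ⊆ 𝓗)
    (hb : ∀ G ∈ 𝒢, Bornology.IsBounded (polytope G)) (n : ℕ) (lab₀ : Finset (E3 × ℝ) → Option (Fin n)) :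
    (⋃ G ∈ 𝒢, polytope G) =ᵐ[volume] ⋃ j, (refineCells 𝓗 h1 𝒢 h𝒢 hb n lab₀).cell j :=
  (Classical.choose_spec (Classical.choose_spec (exists_refinement_signedH 𝓗 h1 𝒢 h𝒢 hb))).2.2.2.2.2.2.2.2

/-- A cell meeting `polytope G` (`G ⊆ 𝓗`) in a point lies inside it. -/
theorem refineCells_subset_of_mem (𝓗 : Finset (E3 × ℝ)) (h1 : ∀ p ∈ 𝓗, ‖p.1‖ = 1) (𝒢 : Finset (Finset (E3 × ℝ))) (h𝒢 : ∀ G ∈ 𝒢, G ⊆ 𝓗)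
    (hb : ∀ G ∈ 𝒢, Bornology.IsBounded (polytope G)) (n : ℕ) (lab₀ : Finset (E3 × ℝ) → Option (Fin n)) (j : Fin (refineCells 𝓗 h1 𝒢 h𝒢 hb n lab₀).k) {G : Finset (E3 × ℝ)} (hG : G ⊆ 𝓗) {x : E3}
    (hx : x ∈ (refineCells 𝓗 h1 𝒢 h𝒢 hb n lab₀).cell j) (hxG : x ∈ polytope G) :
    (refineCells 𝓗 h1 𝒢 h𝒢 hb n lab₀).cell j ⊆ polytope G := by
  rcases refineCells_dichotomy 𝓗 h1 𝒢 h𝒢 hb n lab₀ j G hG with h | h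
  · exact h
  · exact absurd hxG (Set.disjoint_left.1 h hx)

end Refine

end Summit.Ventures.Crystal3D.Cruxes.TextureLiminf.TexShadow

end
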